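import Literature.Analysis.FluidPDE.HardSphereCollisionRecord
import Literature.Analysis.FluidPDE.HardSphereDynamicsProofs
import Literature.MathematicalPhysics.KineticTheory.HardSphereEuler

/-!
# `JParityClosure.RateFloor` (stmt-AtomisticToContinuum-13080), line `Sketch`, stub S6c:
# the unit-mark count transfer `stub_countTransfer`

Helper file (`--supports stmt-AtomisticToContinuum-13080`) discharging the registered stub S6c
`stub_countTransfer` of the lead's skeleton for the crux `JParityClosure.RateFloor`, line
`Sketch` (stated exactly as registered: one antecedent, the text of the window pre-emption
bound S3, then the conclusion).  On a hard-sphere trajectory `γ` on `𝕋³` with diameter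
`0 < ε < 1/2`, windows of length `Δ > 0` and a horizon `τ ≥ 0`, the static would-be counts
`#W_k` of the window-start configurations `γ (kΔ)`, net of their clustering excess `C₂(W_k)`,
summed over the `⌊τ/Δ⌋₊` windows inside `[0, τ]`, are at most twice the unit-mark collision
functional `∑ᶠ_{u ∈ collisionTimes ∩ [0, τ]} ∑ᵢ ∑ⱼ 1[i ≠ j, ‖xᵢ(u) − xⱼ(u)‖ = ε]`.

Proof.  (1) Per window `(kΔ, kΔ + Δ]`, `k < ⌊τ/Δ⌋₊`, the antecedent gives
`#W_k ≤ 2·#A_k + C₂(W_k)` with `A_k` the ordered pairs in contact at some time of the window.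
(2) `#A_k ≤ ∑_{u ∈ T_k} #contactPairs(γ u)`, `T_k` the collision times of the window: a pair in
contact at `u` makes `u` a collision time (`mem_collisionTimes_of_mem_contactPairs`), so `A_k`
lies in the union over `T_k` of the contact pairs (`Finset.card_biUnion_le`).  (3) Inside the
hard-sphere domain `#contactPairs(γ u)` is the inline double sum (`sum_contactPairs_eq`).
(4) The windows are pairwise disjoint and inside `[0, τ]` (`(k+1)Δ ≤ ⌊τ/Δ⌋₊Δ ≤ τ`), so the
window sums add up to at most the sum over all collision times of `[0, τ]`
(`Finset.sum_biUnion`, nonnegative summands), which is the `finsum` of the statement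
(`finsum_mem_eq_finite_toFinset_sum`, the set being finite by `IsHardSphereTrajectory.locFinite`).
-/

noncomputable section

open scoped BigOperators Classical
open MeasureTheory Set Filter Topology

namespace Summit.AtomisticToContinuum.HydrodynamicLimit.Theorems

open Literature.Analysis.FluidPDE Literature.MathematicalPhysics.KineticTheory

namespace RateFloorCountTransfer

variable {d : Type*} [Fintype d] {X : Type*} [TopologicalSpace X] {N : ℕ} {G : Geometry d X}
  {ε : ℝ} {γ : ℝ → Config N d X}

/-- On a hard-sphere trajectory the inline unit-mark double sum
`∑ᵢ ∑ⱼ 1[i ≠ j, ‖xᵢ − xⱼ‖ = ε]` at time `u` is the number of ordered contact pairs of `γ u`.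
[folklore] -/
theorem sum_sum_ite_eq_card_contactPairs (h : IsHardSphereTrajectory G ε N γ) (u : ℝ) :
    (∑ i : Fin N, ∑ j : Fin N,
        (if i ≠ j ∧ ‖G.sepVec (γ u i).1 (γ u j).1‖ = ε then (1 : ℝ) else 0)) =
      ((contactPairs G ε (γ u)).card : ℝ) := by
  rw [Finset.card_eq_sum_ones, Nat.cast_sum]
  simp only [Nat.cast_one]
  exact (sum_contactPairs_eq (h.mem u) fun _ _ => (1 : ℝ)).symm

/-- The ordered pairs in contact at some time of a window `(s, t] ⊆ [a, b]` number at most the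
total number of ordered contact pairs over the collision times of `[a, b]` lying in `(s, t]`:
a pair in contact at `u` makes `u` a collision time. [folklore] -/
theorem card_filter_exists_mem_contactPairs_le (h : IsHardSphereTrajectory G ε N γ)
    {s t a b : ℝ} (hst : Set.Ioc s t ⊆ Set.Icc a b) :
    ((Finset.univ.filter fun p : Fin N × Fin N =>
        ∃ u ∈ Set.Ioc s t, p ∈ contactPairs G ε (γ u)).card : ℝ) ≤
      ∑ u ∈ (h.locFinite a b).toFinset.filter (fun u => u ∈ Set.Ioc s t),
        ((contactPairs G ε (γ u)).card : ℝ) := by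
  have hsub : (Finset.univ.filter fun p : Fin N × Fin N =>
      ∃ u ∈ Set.Ioc s t, p ∈ contactPairs G ε (γ u)) ⊆
      ((h.locFinite a b).toFinset.filter (fun u => u ∈ Set.Ioc s t)).biUnion
        fun u => contactPairs G ε (γ u) := by
    intro p hp
    obtain ⟨u, hu, hpu⟩ := (Finset.mem_filter.1 hp).2
    refine Finset.mem_biUnion.2 ⟨u, Finset.mem_filter.2 ⟨?_, hu⟩, hpu⟩
    exact (h.locFinite a b).mem_toFinset.2 ⟨mem_collisionTimes_of_mem_contactPairs hpu, hst hu⟩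
  exact_mod_cast (Finset.card_le_card hsub).trans Finset.card_biUnion_le

/-- Summing a nonnegative function over the parts of a finite set of reals cut out by the
pairwise disjoint windows `(kΔ, kΔ + Δ]`, `k < n`, gives at most its sum over the whole set.
[folklore] -/
theorem sum_range_sum_filter_window_le (T : Finset ℝ) (g : ℝ → ℝ) (hg : ∀ u ∈ T, 0 ≤ g u)
    {Δ : ℝ} (hΔ : 0 < Δ) (n : ℕ) :
    ∑ k ∈ Finset.range n,
        ∑ u ∈ T.filter (fun u => u ∈ Set.Ioc ((k : ℝ) * Δ) (k * Δ + Δ)), g u ≤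
      ∑ u ∈ T, g u := by
  have key : ∀ k k' : ℕ, k < k' →
      Disjoint (T.filter (fun u => u ∈ Set.Ioc ((k : ℝ) * Δ) (k * Δ + Δ)))
        (T.filter (fun u => u ∈ Set.Ioc ((k' : ℝ) * Δ) (k' * Δ + Δ))) := by
    intro k k' hlt
    have h1 : (k : ℝ) + 1 ≤ k' := by exact_mod_cast Nat.lt_iff_add_one_le.1 hlt
    have h2 : ((k : ℝ) + 1) * Δ ≤ k' * Δ := mul_le_mul_of_nonneg_right h1 hΔ.le
    refine Finset.disjoint_left.2 fun u hu hu' => ?_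
    have hk2 := (Finset.mem_filter.1 hu).2.2
    have hk1' := (Finset.mem_filter.1 hu').2.1
    linarith
  have hdisj : (↑(Finset.range n) : Set ℕ).PairwiseDisjoint
      fun k : ℕ => T.filter (fun u => u ∈ Set.Ioc ((k : ℝ) * Δ) (k * Δ + Δ)) := by
    intro k _ k' _ hne
    rcases Nat.lt_or_gt_of_ne hne with hlt | hlt
    · exact key k k' hlt
    · exact (key k' k hlt).symm
  rw [← Finset.sum_biUnion hdisj]
  exact Finset.sum_le_sum_of_subset_of_nonneg
    (Finset.biUnion_subset.2 fun k _ => Finset.filter_subset _ _) fun u hu _ => hg u hu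

/-- **Window summation.**  If window by window (`(kΔ, kΔ + Δ]`, `k < n`, `nΔ ≤ τ`) the numbers
`a k` are at most twice the number of ordered pairs in contact at some time of the window, then
`∑_{k < n} a k` is at most twice the total number of ordered contact pairs over the collision
times of `[0, τ]`. [folklore] -/
theorem sum_range_le_two_mul_sum_card_contactPairs (h : IsHardSphereTrajectory G ε N γ)
    {Δ τ : ℝ} (hΔ : 0 < Δ) {n : ℕ} (hn : (n : ℝ) * Δ ≤ τ) (a : ℕ → ℝ)
    (ha : ∀ k : ℕ, k < n → a k ≤ 2 * ((Finset.univ.filter fun p : Fin N × Fin N =>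
        ∃ u ∈ Set.Ioc ((k : ℝ) * Δ) (k * Δ + Δ), p ∈ contactPairs G ε (γ u)).card : ℝ)) :
    ∑ k ∈ Finset.range n, a k ≤
      2 * ∑ u ∈ (h.locFinite 0 τ).toFinset, ((contactPairs G ε (γ u)).card : ℝ) := by
  calc ∑ k ∈ Finset.range n, a k
      ≤ ∑ k ∈ Finset.range n, 2 * ∑ u ∈ (h.locFinite 0 τ).toFinset.filter
            (fun u => u ∈ Set.Ioc ((k : ℝ) * Δ) (k * Δ + Δ)),
          ((contactPairs G ε (γ u)).card : ℝ) := by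
        refine Finset.sum_le_sum fun k hk => (ha k (Finset.mem_range.1 hk)).trans ?_
        refine mul_le_mul_of_nonneg_left (card_filter_exists_mem_contactPairs_le h ?_) two_pos.le
        have hk1 : ((k : ℝ) + 1) * Δ ≤ n * Δ :=
          mul_le_mul_of_nonneg_right
            (by exact_mod_cast Nat.lt_iff_add_one_le.1 (Finset.mem_range.1 hk)) hΔ.le
        have hk0 : 0 ≤ (k : ℝ) * Δ := mul_nonneg k.cast_nonneg hΔ.le
        intro u hu
        exact ⟨by linarith [hu.1], by linarith [hu.2]⟩
    _ = 2 * ∑ k ∈ Finset.range n, ∑ u ∈ (h.locFinite 0 τ).toFinset.filter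
            (fun u => u ∈ Set.Ioc ((k : ℝ) * Δ) (k * Δ + Δ)),
          ((contactPairs G ε (γ u)).card : ℝ) := by
        rw [Finset.mul_sum]
    _ ≤ 2 * ∑ u ∈ (h.locFinite 0 τ).toFinset, ((contactPairs G ε (γ u)).card : ℝ) :=
        mul_le_mul_of_nonneg_left
          (sum_range_sum_filter_window_le _ _ (fun u _ => Nat.cast_nonneg _) hΔ n) two_pos.le

/-- Casting the per-window pre-emption count `w ≤ 2a + c` to `ℝ` in the form `w − c ≤ 2a`.
[folklore] -/
theorem cast_sub_le_of_le_two_mul_add (w a c : ℕ) (hw : w ≤ 2 * a + c) :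
    (w : ℝ) - (c : ℝ) ≤ 2 * (a : ℝ) := by
  have : (w : ℝ) ≤ 2 * a + c := by exact_mod_cast hw
  linarith

/-- **S6c · unit-mark count transfer** (registered stub `stub_countTransfer` of the line `Sketch`
for `JParityClosure.RateFloor`, verbatim).  Given the window pre-emption bound (the text of the
neighbouring stub S3) as hypothesis: on a hard-sphere trajectory on `𝕋³` with `0 < ε < 1/2`,
for windows of length `Δ > 0` and a horizon `τ ≥ 0`, the would-be counts of the window starts,
net of their clustering excesses, summed over the `⌊τ/Δ⌋₊` windows, are at most twice the
unit-mark collision functional on `[0, τ]`. [folklore] -/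
theorem stub_countTransfer :
    (∀ (N : ℕ) (ε : ℝ) (γ : ℝ → Config N (Fin 3) T3),
      IsHardSphereTrajectory (Torus.geometry (Fin 3)) ε N γ → 0 < ε → ε < 2⁻¹ →
      ∀ (s t : ℝ), s < t →
        ∀ (W A : Finset (Fin N × Fin N)),
        (W = Finset.univ.filter fun p => p.1 ≠ p.2 ∧
          ∃ u ∈ Set.Ioc 0 (t - s), ‖(Torus.geometry (Fin 3)).sepVec
            (freeFlight (Torus.geometry (Fin 3)) u (γ s) p.1).1 (freeFlight (Torus.geometry (Fin 3)) u (γ s) p.2).1‖ ≤ ε) →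
        (A = Finset.univ.filter fun p =>
          ∃ u ∈ Set.Ioc s t, p ∈ contactPairs (Torus.geometry (Fin 3)) ε (γ u)) →
        W.card ≤ 2 * A.card +
          ∑ i ∈ Finset.univ.filter (fun i => 2 ≤ (W.filter fun p => p.1 = i ∨ p.2 = i).card),
            (W.filter fun p => p.1 = i ∨ p.2 = i).card) →
    ∀ (N : ℕ) (ε : ℝ) (γ : ℝ → Config N (Fin 3) T3),
    IsHardSphereTrajectory (Torus.geometry (Fin 3)) ε N γ → 0 < ε → ε < 2⁻¹ →
    ∀ (Δ τ : ℝ), 0 < Δ → 0 ≤ τ →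
      ∀ (W : ℕ → Finset (Fin N × Fin N)),
      (∀ k : ℕ, W k = Finset.univ.filter fun p => p.1 ≠ p.2 ∧
        ∃ u ∈ Set.Ioc 0 Δ, ‖(Torus.geometry (Fin 3)).sepVec
          (freeFlight (Torus.geometry (Fin 3)) u (γ (k * Δ)) p.1).1
          (freeFlight (Torus.geometry (Fin 3)) u (γ (k * Δ)) p.2).1‖ ≤ ε) →
      ∑ k ∈ Finset.range ⌊τ / Δ⌋₊, (((W k).card : ℝ) -
          ((∑ i ∈ Finset.univ.filter (fun i => 2 ≤ ((W k).filter fun p => p.1 = i ∨ p.2 = i).card),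
            ((W k).filter fun p => p.1 = i ∨ p.2 = i).card : ℕ) : ℝ)) ≤
        2 * ∑ᶠ (u : ℝ) (_ : u ∈ collisionTimes (Torus.geometry (Fin 3)) ε γ ∩ Set.Icc 0 τ),
          ∑ i : Fin N, ∑ j : Fin N,
            (if i ≠ j ∧ ‖(Torus.geometry (Fin 3)).sepVec (γ u i).1 (γ u j).1‖ = ε then (1 : ℝ) else 0) := by
  intro hWPB N ε γ h hε hε2 Δ τ hΔ hτ W hW
  rw [finsum_mem_eq_finite_toFinset_sum _ (h.locFinite 0 τ),
    Finset.sum_congr rfl fun u _ => sum_sum_ite_eq_card_contactPairs h u]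
  -- the per-window pre-emption bound, cast to `ℝ`
  have hwin : ∀ k : ℕ, k < ⌊τ / Δ⌋₊ →
      ((W k).card : ℝ) -
          ((∑ i ∈ Finset.univ.filter
              (fun i => 2 ≤ ((W k).filter fun p => p.1 = i ∨ p.2 = i).card),
            ((W k).filter fun p => p.1 = i ∨ p.2 = i).card : ℕ) : ℝ) ≤
        2 * ((Finset.univ.filter fun p : Fin N × Fin N =>
          ∃ u ∈ Set.Ioc ((k : ℝ) * Δ) (k * Δ + Δ),
            p ∈ contactPairs (Torus.geometry (Fin 3)) ε (γ u)).card : ℝ) := by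
    intro k _
    refine cast_sub_le_of_le_two_mul_add _ _ _
      (hWPB N ε γ h hε hε2 (k * Δ) (k * Δ + Δ) (by linarith) (W k) _ ?_ rfl)
    rw [hW k, add_sub_cancel_left]
  exact sum_range_le_two_mul_sum_card_contactPairs h hΔ
    ((le_div_iff₀ hΔ).1 (Nat.floor_le (div_nonneg hτ hΔ.le))) _ hwin

end RateFloorCountTransfer

end Summit.AtomisticToContinuum.HydrodynamicLimit.Theorems

end
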